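import Literature.AlgebraicGeometry.Frobenioids.BiratFrobeniusCompactCriterion
import Literature.AlgebraicGeometry.Frobenioids.ArithmeticFrobenioidRationallyStandard
import HarnessLib

/-!
# Frobenioids I, Theorem 6.4 (i): every object of `(C_{K/F}^un-tr)^birat` is Frobenius-compact, and Thm. 6.4 (i)
# (Frobenioid part) HOLDS at THE parameters of Def. 4.5 (iii) — PROOFS (sub-DAG row T64i/L10 closed)

Mochizuki, *The geometry of Frobenioids I: the general theory*, Kyushu J. Math. **62** (2008) 293–400, Thm. 6.4
(i), kurims p. 114, proof p. 115 ll. 22–24: "Moreover, by considering the effect of automorphisms of number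
fields on arithmetic divisors, it follows … that every object of `(C^un-tr)^birat` is Frobenius-compact. Thus, `C`
is of rationally standard type" [cite: MochizukiFrdI2008, Thm. 6.4 (i) p.115]; Def. 4.5 (iii)(b) p. 86
[cite: MochizukiFrdI2008, Def. 4.5 (iii) p.86].

PROOF-ONLY (theorems, no `def`; cell abc-iut, seat abc-iut-L6-t10 gen 3, holder of the [FrdI] §6 sub-DAG).
Seat abc-iut-L6-t10 gen 2's `ArithmeticFrobenioidRationallyStandard.lean` proved Thm. 6.4 (i) "isotropic and
rationally standard but not group-like" for THE constructed `C_{K/F}` at THE parameters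
`PreFrobenioid.rsParams hF PrimarySupp` (THE birationalization, the support predicate of Def. 2.4 (i)(d) read
on primary elements, THE unit-trivialization and ITS birationalization) UP TO the one input
"`(C^un-tr)^birat` admits a Frobenius-compact object" (`Thm64i_frobenioid_rsParams_iff`).  This file supplies
that input by the generic criterion `PreFrobenioid.Birat.untr_isFrobenioidCompact_of_invariant` (gen 3, file
`BiratFrobeniusCompactCriterion.lean`) at the rational function `2`:
* `gpEquiv_divB`, `gpEquiv_symm_principalArithDivisor_two_pow_ne_one`, `arithFrobenioid_divB_two_pow_ne_one`,
  `arithFrobenioid_divB_two_mem_biratSubgroup`, `arithFrobenioid_pullGp_divB_two` — `d₀ = div(2)`: a rational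
  divisor (`Φ^birat(A_D) = Div_B(B(A_D))`, gen 2's `mem_biratSubgroup_iff_exists_divB`), NON-TORSION in `Φ^gp(L)`
  (its component at an archimedean place `w` is `-log|2|_w = -log 2 ≠ 0`), and `σ^* div(2) = div(σ 2) = div(2)`
  for every arrow `σ` of `D` ("the effect of automorphisms of number fields on arithmetic divisors");
* `arithFrobenioid_untrBirat_isFrobeniusCompact` — **every object `[A]^birat` of `(C_{K/F}^un-tr)^birat` is
  Frobenius-compact** (all objects of `C_{K/F}` are isotropic; `C^un-tr` has the objects of `C^istr = C`);
  `arithFrobenioid_untrBirat_isFrobeniusCompact_all` — the same for EVERY object of THE `(C^un-tr)^birat` (each is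
  such an image); `arithFrobenioid_exists_isFrobeniusCompact` — Def. 4.5 (iii)(b) at THE `(C^un-tr)^birat`;
* `arithFrobenioid_isOfRationallyStandardType_rsParams` — **`C_{K/F}` IS of rationally standard type at THE
  parameters** (gen 2's `arith_isOfRationallyStandardType_rsParams_iff`);
* **`Thm64i_frobenioid_rsParams : Thm64i_frobenioid (arithModelFrobenioid F K) (PreFrobenioid.rsParams … PrimarySupp)`**
  — seat abc-iut-L1-t3's typed Thm. 6.4 (i), Frobenioid part, CLOSED at THE constructions, no free parameter
  (gen 2's `Thm64i_frobenioid_rsParams_of_frobCompact`); with gen 0's `Thm64i_base_arith` this is Thm. 6.4 (i) for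
  `C` itself.

Standard axioms only. Nothing here bears on [IUTchIII] Cor. 3.12 or asserts anything about abc.
-/

noncomputable section

namespace Literature.AlgebraicGeometry.Frobenioids

open CategoryTheory Opposite Function NumberField

section Arith

variable (F : Type) [Field F] [NumberField F] (K : Type) [Field K] [Algebra F K]

/-! ### The rational function `2` and its divisor -/

/-- `Div_B(f)` of Ex. 6.3 read in `ArithDivisor L`: it is `div(f)` (unfolding `divNatTrans`).
[cite: MochizukiFrdI2008, Ex. 6.3 p.113] -/
theorem gpEquiv_divB (X : FinSubextCat F K) (f : (X.L)ˣ) :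
    EffArithDivisor.gpEquiv X.L
        (divB (arithDivisorFunctor F K) (unitsFunctor F K) (divNatTrans F K) (op X) f) =
      principalArithDivisorHom X.L f := by
  change EffArithDivisor.gpEquiv X.L ((EffArithDivisor.gpEquiv X.L).symm (principalArithDivisorHom X.L f)) = _
  rw [MulEquiv.apply_symm_apply]

/-- `div(2)` is a NON-TORSION element of `Φ^gp(L)` (written through `Φ(L)^gp ≅ ArithDivisor L`): its component at
an archimedean place `w` is `-log|2|_w = -log 2 ≠ 0`. [cite: MochizukiFrdI2008, Ex. 6.3 p.113] -/
theorem gpEquiv_symm_principalArithDivisor_two_pow_ne_one (X : FinSubextCat F K) (N : ℕ) (hN : 0 < N) :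
    (EffArithDivisor.gpEquiv X.L).symm (principalArithDivisorHom X.L (Units.mk0 (2 : X.L) two_ne_zero)) ^ N ≠
      1 := by
  intro h
  have h' := congrArg (EffArithDivisor.gpEquiv X.L) h
  rw [map_pow, MulEquiv.apply_symm_apply, map_one, ← map_pow] at h'
  -- `div(2^N) = 0` in `ArithDivisor L`; read its component at an archimedean place
  have h'' : principalArithDivisor X.L (Units.mk0 (2 : X.L) two_ne_zero ^ N) = 0 := ofAdd_eq_one.mp h'
  obtain ⟨w⟩ := (inferInstance : Nonempty (InfinitePlace X.L))
  have hw := congrArg (fun d : ArithDivisor X.L => d.2 w) h''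
  rw [principalArithDivisor_snd, Units.val_pow_eq_pow_val, Units.val_mk0, map_pow, Real.log_pow,
    Prod.snd_zero, Pi.zero_apply, neg_eq_zero, mul_eq_zero] at hw
  have h2 : (w : InfinitePlace X.L) (2 : X.L) = 2 := by
    rw [← InfinitePlace.mk_embedding w, InfinitePlace.apply, map_ofNat]
    simp
  rcases hw with hw | hw
  · exact (Nat.pos_iff_ne_zero.mp hN) (by exact_mod_cast hw)
  · rw [h2] at hw
    exact (Real.log_pos one_lt_two).ne' hw

/-- `div(2) = Div_B(2)` is a NON-TORSION element of `Φ^gp(L)` (the previous lemma, `Div_B` of Ex. 6.3 being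
`f ↦ div(f)` read through `Φ(L)^gp ≅ ArithDivisor L`). [cite: MochizukiFrdI2008, Ex. 6.3 p.113] -/
theorem arithFrobenioid_divB_two_pow_ne_one (X : FinSubextCat F K) (N : ℕ) (hN : 0 < N) :
    divB (arithDivisorFunctor F K) (unitsFunctor F K) (divNatTrans F K) (op X)
        (Units.mk0 (2 : X.L) two_ne_zero) ^ N ≠ 1 :=
  gpEquiv_symm_principalArithDivisor_two_pow_ne_one F K X N hN

/-- `σ^* div(2) = div(σ 2) = div(2)` for every arrow `σ : Spec L' → Spec L` of `D` — "the effect of automorphisms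
of number fields on arithmetic divisors" (p. 115 l. 22) in the one instance the criterion needs: naturality of
`Div_B` (`B → Φ^gp` is a homomorphism of monoids on `D`) and `σ(2) = 2`. [cite: MochizukiFrdI2008, Thm. 6.4 (i) p.115] -/
theorem arithFrobenioid_pullGp_divB_two {X Y : FinSubextCat F K} (σ : Y ⟶ X) :
    pullGp (arithDivisorFunctor F K) σ
        (divB (arithDivisorFunctor F K) (unitsFunctor F K) (divNatTrans F K) (op X)
          (Units.mk0 (2 : X.L) two_ne_zero)) =
      divB (arithDivisorFunctor F K) (unitsFunctor F K) (divNatTrans F K) (op Y)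
        (Units.mk0 (2 : Y.L) two_ne_zero) := by
  rw [pullGp_divB]
  congr 1
  refine Units.ext ?_
  change σ.toAlgHom (2 : X.L) = 2
  exact map_ofNat σ.toAlgHom 2

variable [IsGalois F K]

/-- `div(2) ∈ Φ^birat(L)` — the divisor of a rational function lies in THE rational-function subfunctor of
`C_{K/F}` (Thm. 5.2 (ii) "Moreover": `Φ^birat(A_D) = Div_B(B(A_D))` for a model Frobenioid, seat abc-iut-L6-t10
gen 2's `mem_biratSubgroup_iff_exists_divB`). [cite: MochizukiFrdI2008, Thm. 5.2 (ii) p.101] -/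
theorem arithFrobenioid_divB_two_mem_biratSubgroup (X : arithFrobenioid F K) :
    divB (arithDivisorFunctor F K) (unitsFunctor F K) (divNatTrans F K) (op X.base)
        (Units.mk0 (2 : X.base.L) two_ne_zero) ∈
      PreFrobenioid.biratSubgroup
        (ModelFrobenioid.toElem (arithDivisorFunctor F K) (unitsFunctor F K) (divNatTrans F K))
        (PreFrobenioid.baseObj
          (ModelFrobenioid.toElem (arithDivisorFunctor F K) (unitsFunctor F K) (divNatTrans F K)) X) :=
  (ModelFrobenioid.mem_biratSubgroup_iff_exists_divB (unitsFunctor_isGroupLike F K)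
    (arithDivisorFunctor_isDivisorial F K) (arithFrobenioid_isFrobenioid F K) X _).mpr ⟨_, rfl⟩

/-! ### Def. 4.5 (iii)(b): Frobenius-compact objects of `(C_{K/F}^un-tr)^birat` -/

/-- **"every object of `(C^un-tr)^birat` is Frobenius-compact"** (p. 115 ll. 22–23) — for the image `[A]^birat` of
every `A ∈ Ob(C_{K/F})` (all objects are isotropic; `C^un-tr` has the objects of `C^istr = C`, and every object of
`(C^un-tr)^birat` is such an image): the generic criterion `Birat.untr_isFrobeniusCompact_of_invariant` at
`d₀ = div(2)`. [cite: MochizukiFrdI2008, Thm. 6.4 (i) p.115] -/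
theorem arithFrobenioid_untrBirat_isFrobeniusCompact (X : arithFrobenioid F K) :
    (PreFrobenioid.rsParams (arithFrobenioid_isFrobenioid F K) fun a 𝔭 => PrimarySupp a 𝔭).BU.ops.IsFrobeniusCompact
      ((PreFrobenioid.rsParams (arithFrobenioid_isFrobenioid F K) fun a 𝔭 => PrimarySupp a 𝔭).BU.toBirat.obj
        ((arithFrobenioidOps F K).toUntr.obj ⟨X, (isOfIsotropicType_arith F K).obj X⟩)) :=
  PreFrobenioid.Birat.untr_isFrobeniusCompact_of_invariant (arithFrobenioid_isFrobenioid F K)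
    ((arithFrobenioidOps F K).toUntr.obj ⟨X, (isOfIsotropicType_arith F K).obj X⟩)
    (divB (arithDivisorFunctor F K) (unitsFunctor F K) (divNatTrans F K) (op X.base)
      (Units.mk0 (2 : X.base.L) two_ne_zero))
    (arithFrobenioid_divB_two_mem_biratSubgroup F K X)
    (arithFrobenioid_divB_two_pow_ne_one F K X.base)
    (fun _ => arithFrobenioid_pullGp_divB_two F K _)

/-- **"every object of `(C^un-tr)^birat` is Frobenius-compact"** (p. 115 ll. 22–23), literally: for EVERY object
`Y` of THE `(C_{K/F}^un-tr)^birat` (each is the image `[A]^birat` of an object `A` of `C_{K/F}`, the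
birationalization and the unit-trivialization having the objects of `C^istr = C`; `A := Y.as.obj`). [cite: MochizukiFrdI2008, Thm. 6.4 (i) p.115] -/
theorem arithFrobenioid_untrBirat_isFrobeniusCompact_all
    (Y : (PreFrobenioid.rsParams (arithFrobenioid_isFrobenioid F K) fun a 𝔭 => PrimarySupp a 𝔭).BU.Birat) :
    (PreFrobenioid.rsParams (arithFrobenioid_isFrobenioid F K) fun a 𝔭 => PrimarySupp a 𝔭).BU.ops.IsFrobeniusCompact
      Y :=
  arithFrobenioid_untrBirat_isFrobeniusCompact F K (Y : (arithFrobenioidOps F K).Untr).as.obj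

/-- **Def. 4.5 (iii)(b) for `C_{K/F}` at THE `(C^un-tr)^birat`**: it admits a Frobenius-compact object (e.g. the
image of the object `(Spec F, 0)`) — the one input left open by gen 2's `Thm64i_frobenioid_rsParams_iff`.
[cite: MochizukiFrdI2008, Thm. 6.4 (i) p.115] -/
theorem arithFrobenioid_exists_isFrobeniusCompact :
    ∃ Y : (PreFrobenioid.rsParams (arithFrobenioid_isFrobenioid F K) fun a 𝔭 => PrimarySupp a 𝔭).BU.Birat,
      (PreFrobenioid.rsParams (arithFrobenioid_isFrobenioid F K) fun a 𝔭 => PrimarySupp a 𝔭).BU.ops.IsFrobeniusCompact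
        Y :=
  ⟨_, arithFrobenioid_untrBirat_isFrobeniusCompact F K ⟨⟨⊥⟩, 1⟩⟩

/-! ### Theorem 6.4 (i) at THE parameters, unconditionally -/

/-- **Theorem 6.4 (i): `C_{K/F}` IS of rationally standard type** (Def. 4.5 (iii)) at THE parameters
`(C^birat, Supp, C^un-tr, (C^un-tr)^birat)` — no input left. [cite: MochizukiFrdI2008, Thm. 6.4 (i) p.114] -/
theorem arithFrobenioid_isOfRationallyStandardType_rsParams :
    (arithFrobenioidOps F K).IsOfRationallyStandardType
      (PreFrobenioid.rsParams (arithFrobenioid_isFrobenioid F K) fun a 𝔭 => PrimarySupp a 𝔭) :=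
  (arith_isOfRationallyStandardType_rsParams_iff F K).mpr (arithFrobenioid_exists_isFrobeniusCompact F K)

/-- **[FrdI] Theorem 6.4 (i), Frobenioid part, AS TYPED by seat abc-iut-L1-t3 (`Thm64i_frobenioid`), CLOSED at
THE constructions**: THE arithmetic model Frobenioid `C_{K/F}` (`arithModelFrobenioid F K`) "[is] of isotropic
and rationally standard type, but not of group-like type", rationally standard being read at THE parameters of
Def. 4.5 (iii) (`PreFrobenioid.rsParams`: THE birationalization, the support of Def. 2.4 (i)(d), THE
unit-trivialization and its birationalization) — no free parameter, no hypothesis. With gen 0's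
`Thm64i_base_arith` (base part) this is the typed Thm. 6.4 (i) for `C` itself (the `C^pf / C^rlf / C^un-tr`
variants are Prop. 5.5 (iii)'s, row T64i/L11). [cite: MochizukiFrdI2008, Thm. 6.4 (i) p.114] -/
theorem Thm64i_frobenioid_rsParams :
    Thm64i_frobenioid (arithModelFrobenioid F K)
      (PreFrobenioid.rsParams (arithFrobenioid_isFrobenioid F K) fun a 𝔭 => PrimarySupp a 𝔭) :=
  Thm64i_frobenioid_rsParams_of_frobCompact F K (arithFrobenioid_exists_isFrobeniusCompact F K)

end Arith

end Literature.AlgebraicGeometry.Frobenioids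

end
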